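/-
Copyright (c) 2026 the pub-hodgecm-mathlib formalisation cell (harness21).  Prover seat hodgecm-mathlib-LH7-p03 (g2): line LH4 (Shalika pay-down), organ ‹RAO› ∕ RAO-CONV «Regular»,
sub-brick «(II-S) CENTRALISER BALLS ON THE CARRIER» (LH4-plan (g2) DEALER WORDS #39; LH5-p02 (g2) cut 2026-09-02T05:02:00Z); 2026-09-02.
-/
import Literature.NumberTheory.Automorphic.UnitaryThreeRegularUnipotentCentralizerBalls          -- ★ p849366 (LH5-p02 (g2)): `exists_subgroup_scalarRegCentBall`, `relIndex_scalarRegCentBall_eq`; brings ★ REG-FRAME p849269∕p849290 and ★ REG-CENT p849213 (`exists_coe_eq_smul_upperUnipotent_of_commute_regularUnipotent`, `smul_upperUnipotent_mem_unitaryGroupOfForm_and_commute`)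
import Literature.NumberTheory.Rogawski1990.UnipotentOrbitalIntegralConvergenceTransvectionCM    -- ★ p849314 (F0P3a-p09 (g4)): the `T = 1` frame idioms; brings ★ `UnipotentLevelPiecesFrameCM` (`conj_localNonsplitEquiv_{mem,mul,one,injective}`, `exists_conj_localNonsplitEquiv_eq`, `continuous_conj_localNonsplitEquiv_apply`), ★ `isClopen_setOf_valued_le`, ★ `placeForm_antidiagOne`, ★ `Liu2021.galAdicCompletionMap_galAdicCompletionMap_self`
import HarnessLib

/-!
# The level subgroups `S(rₐ, r) = C(γ₀) ∩ ψ⁻¹(Z(U)·B_{rₐ,r})` of the centraliser of a REGULAR unipotent of `U(Φ₃)(L⁺_v)` ON THE CARRIER: open subgroups of `C(γ₀)`,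
# their index is the ball index on the anti-invariant line, monotone in the radii ([Rogawski1990] §3.9, §8.1; [Rao1972])

Topic `NumberTheory/Rogawski1990`; namespace `Literature.NumberTheory.Rogawski1990` (`UnitaryGroup.` prefix).  THEOREMS ONLY (no definition, no instance, no notation, no named
fact, no `sorry`); kernel lane `--supports stmt-HodgeConjecture-24833`.  Cell `pub/hodgecm-mathlib` (D-0151), crux H413 = `stmt-HodgeConjecture-24833`; half A line LH4 (Shalika
pay-down of the print row `stub_N6nsShalika`), organ ‹RAO›, RAO-CONV «Regular» team: (I) covering ★-pending p849367 F0P3a-p09 (g4), (II) shells LH5-p02 (g2) — THIS is its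
sub-brick (II-S) —, (B) shell sum ★ p849341 LH4-p03 (g3), (C) assembly LH7-p01 (g2).

SETTING (that of (I)∕(II), the `T = 1` frame of ★ p849314): `L` CM, `v` a finite place of `L⁺` with `w ∣ v` fixed by complex conjugation (`hw`), the carrier
`G = U(Φ₃)(L⁺_v) = (cmDatum L 3 Φ₃).Local v`, the one-place model `ψ = e = localNonsplitEquiv … w hw : G → U(σ_w, (Φ₃)_w) = U(σ_w, J₀)(L_w) ≤ GL₃(L_w)` (BARE coercion,
no `1 · _ · 1⁻¹` decoration in the exports), `σ = σ_w = galAdicCompletionMap … hw`, and a base point `γ₀ ∈ G` with `ψ γ₀ = u₀ = !![1, 1, −t₀; 0, 1, −1; 0, 0, 1]`.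
By ★ REG-CENT (`exists_coe_eq_smul_upperUnipotent_of_commute_regularUnipotent` ∕ `smul_upperUnipotent_mem_unitaryGroupOfForm_and_commute`) the centraliser is
`C_U(u₀) = Z(U)·C_{U∩N}(u₀) = {ζ • n(a, s) : σζ·ζ = 1, σa = a, σs = −s}`, `n(a, s) = !![1, a, s − a²∕2; 0, 1, −a; 0, 0, 1]` (★ REG-FRAME coordinates), and ★ p849366 makes
`Z(U)·B_{rₐ,r} = {ζ • n(a,s) : v a ≤ rₐ, v s ≤ r}` a subgroup `T(rₐ, r) ≤ GL₃(L_w)` whose index in `T(rₐ, r′)` is the ball index `[B_{r′} ⊓ F⁻ : B_r ⊓ F⁻]` on the anti-invariant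
line `F⁻ = ker(id + σ)`.  THIS FILE transports that to the carrier:
* §0 (private) the frame dictionary at `T = 1` (`ψ` multiplicative, onto `U(σ_w, J₀)`, injective, entrywise continuous; `2 ≠ 0` in `L_w`; `σ_w` an involution).
* §1 **`UnitaryGroup.exists_eq_smul_regCent_of_mem_centralizer`** ∕ **`UnitaryGroup.mem_centralizer_of_eq_smul_regCent`** — `h ∈ C(γ₀)` iff `ψ h = ζ • n(a, s)` with
  `σζ·ζ = 1`, `σa = a`, `σs = −s` (REG-CENT read through `ψ`).
* §2 **`UnitaryGroup.exists_centralizerBall (γ₀) (hγ₀) (rₐ r) (hrₐ : rₐ ≠ 0) (hr : r ≠ 0)`** — (S1): there is a subgroup `S(rₐ, r) ≤ C(γ₀)` with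
  `h ∈ S(rₐ, r) ↔ ∃ ζ a s, σζ·ζ = 1 ∧ σa = a ∧ σs = −s ∧ v a ≤ rₐ ∧ v s ≤ r ∧ ψ h = ζ • n(a, s)`, and it is OPEN in `C(γ₀)`: `S = T(rₐ, r).comap ψ|_{C(γ₀)}`, and on `C(γ₀)` the
  coordinates `a(h) = (ψh)₀₁∕(ψh)₀₀`, `s(h) = (ψh)₀₂∕(ψh)₀₀ + a(h)²∕2` are continuous (`(ψh)₀₀ = ζ ≠ 0`; `L_w` is a topological division ring), so `S(rₐ, r)` is the preimage of two
  clopen valuation balls (★ `isClopen_setOf_valued_le`); (S1′) **`UnitaryGroup.isClosed_centralizerBall`** — it is also closed (same preimage).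
* §3 **`UnitaryGroup.relIndex_centralizerBall_eq (γ₀) (hγ₀) (hS) (hS′)`** — (S2): for `S(rₐ, r)`, `S(rₐ, r′)` given by their membership predicates,
  `[S(rₐ, r′) : S(rₐ, r)] = [B_{r′} ⊓ F⁻ : B_r ⊓ F⁻]` — Mathlib `Subgroup.relIndex_comap` + `Subgroup.map_comap_eq` along `ψ|_{C(γ₀)}`, with `T(rₐ, r′) ≤ range ψ|_{C(γ₀)}`
  (every `ζ • n(a, s)` is unitary and commutes with `u₀`, so it is `ψ y` with `y ∈ C(γ₀)` by surjectivity + injectivity of `ψ`), then ★ `relIndex_scalarRegCentBall_eq`.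
* §4 **`UnitaryGroup.centralizerBall_mono`** — (S3): `S(rₐ, r) ≤ S(rₐ′, r′)` for `rₐ ≤ rₐ′`, `r ≤ r′`.
CONSUMER ((II) `Rogawski1990/UnipotentOrbitShellsRegularCM.lean`): `S j := S(exp(−nₐ), exp(2j))`; `hS₀ = (S1).2`; `hSc` from absorption (★ p849366 §3) + (S1)∕(S1′);
`hgr` from (S2) + ★ p849305 `relIndex_mul_pow_two_le`.
HONEST LABEL: count-neutral brick (topological∕index bookkeeping through the one-place model); HC_CM is proved only modulo the 7 printed citations (2 remaining named inputs:
hLiu418 = stmt-HodgeConjecture-24832, h413 = stmt-HodgeConjecture-24833) until rung 0 closes.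

## References
* [Rogawski1990] J. D. Rogawski, *Automorphic Representations of Unitary Groups in Three Variables*, Ann. of Math. Stud. 123 (1990): §3.9 Prop. 3.9.1 p. 32 (the regular class
  and its centraliser `Z·C_N(u)`), §8.1 p. 112 (convergence of unipotent orbital integrals).
* [Rao1972] R. Ranga Rao, *Orbital integrals in reductive groups*, Ann. of Math. (2) 96 (1972) 505–510 (the compact open subgroups of the centraliser in the proof of the Theorem).
* [PlatonovRapinchuk1994] V. Platonov, A. Rapinchuk, *Algebraic Groups and Number Theory* (1994), §2.3, §5.1 (the one-place model of a unitary group at a non-split place).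
-/

set_option autoImplicit false

noncomputable section

open scoped Matrix MatrixGroups Valued WithZero
open Matrix Topology Set NumberField IsDedekindDomain

namespace Literature.NumberTheory.Rogawski1990

open Literature.NumberTheory.Automorphic Literature.NumberTheory.Automorphic.UnitaryGroup Literature.NumberTheory.GaloisRepresentations
open Literature.NumberTheory.Automorphic.UnitaryLatticeTree Literature.NumberTheory.Automorphic.HermitianLattice

variable (L : Type) [Field L] [NumberField L] [IsCMField L] (v : HeightOneSpectrum (𝓞 ↥(maximalRealSubfield L)))
  (w : PlacesOver L v) (hw : IsCMField.complexConj L • w.1 = w.1)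

/-! ## §0 The frame at `T = 1` (private dictionary) -/

omit [IsCMField L] in
/-- `2 ≠ 0` in the local field `L_w` (it contains the number field `L`). [cite: PlatonovRapinchuk1994, §1.1] -/
private theorem two_ne_zero_adicCompletion : (2 : (w.1.adicCompletion L)) ≠ 0 := by
  rw [← map_ofNat (algebraMap L (w.1.adicCompletion L)) 2]
  exact (map_ne_zero (algebraMap L (w.1.adicCompletion L))).2 two_ne_zero

/-- `σ_w` is an involution of `L_w`. [cite: PlatonovRapinchuk1994, §2.3] -/
private theorem gal_invol (x : (w.1.adicCompletion L)) : (galAdicCompletionMap (L := L) (IsCMField.complexConj L) hw) ((galAdicCompletionMap (L := L) (IsCMField.complexConj L) hw) x) = x :=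
  Literature.NumberTheory.Automorphic.Liu2021.galAdicCompletionMap_galAdicCompletionMap_self _ L (IsCMField.complexConj L)
    (AlgEquiv.ext fun y => IsCMField.complexConj_apply_apply L y) hw x

/-- **The frame dictionary at `T = 1`** (★ `UnipotentLevelPiecesFrameCM` with the decoration `1 · _ · 1⁻¹` stripped): `ψ = e` takes values in `U(σ_w, J₀)(L_w)`, is
multiplicative, sends `1` to `1`, is onto `U(σ_w, J₀)(L_w)`, is injective, and its matrix entries are continuous. [cite: PlatonovRapinchuk1994, §2.3, §5.1] -/
private theorem frame_dictionary :
    (∀ y : ((cmDatum L 3 (Matrix.of fun i j : Fin 3 => if i.val + j.val + 1 = 3 then (1 : L) else 0)).Local v), ((localNonsplitEquiv (IsCMField.complexConj L) (Matrix.of fun i j : Fin 3 => if i.val + j.val + 1 = 3 then (1 : L) else 0) (IsCMField.complexConj_ne_one L) w hw y : ↥(unitaryGroupOfForm (galAdicCompletionMap (L := L) (IsCMField.complexConj L) hw) (placeForm (Matrix.of fun i j : Fin 3 => if i.val + j.val + 1 = 3 then (1 : L) else 0) w.1))) : GL (Fin 3) (w.1.adicCompletion L)) ∈ (unitaryGroupOfForm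 (galAdicCompletionMap (L := L) (IsCMField.complexConj L) hw) ((StdForm.antidiagonal 3).over (w.1.adicCompletion L)))) ∧
    (∀ y y' : ((cmDatum L 3 (Matrix.of fun i j : Fin 3 => if i.val + j.val + 1 = 3 then (1 : L) else 0)).Local v), ((localNonsplitEquiv (IsCMField.complexConj L) (Matrix.of fun i j : Fin 3 => if i.val + j.val + 1 = 3 then (1 : L) else 0) (IsCMField.complexConj_ne_one L) w hw (y * y') : ↥(unitaryGroupOfForm (galAdicCompletionMap (L := L) (IsCMField.complexConj L) hw) (placeForm (Matrix.of fun i j : Fin 3 => if i.val + j.val + 1 = 3 then (1 : L) else 0) w.1))) : GL (Fin 3) (w.1.adicCompletion L)) = ((localNonsplitEquiv (IsCMField.complexConj L) (Matrix.of fun i j : Fin 3 => if i.val + j.val + 1 = 3 then (1 : L) else 0) (IsCMField.complexConj_ne_one L) w hw y : ↥(unitaryGroupOfForm (galAdicCompletionMap (L := L) (IsCMField.complexConj L) hw) (placeForm (Matrix.of fun i j : Fin 3 => if i.val + j.val + 1 = 3 then (1 : L) else 0) w.1))) : GL (Fin 3) (w.1.adicCompletion L)) * ((localNonsplitEquiv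 (IsCMField.complexConj L) (Matrix.of fun i j : Fin 3 => if i.val + j.val + 1 = 3 then (1 : L) else 0) (IsCMField.complexConj_ne_one L) w hw y' : ↥(unitaryGroupOfForm (galAdicCompletionMap (L := L) (IsCMField.complexConj L) hw) (placeForm (Matrix.of fun i j : Fin 3 => if i.val + j.val + 1 = 3 then (1 : L) else 0) w.1))) : GL (Fin 3) (w.1.adicCompletion L))) ∧
    (((localNonsplitEquiv (IsCMField.complexConj L) (Matrix.of fun i j : Fin 3 => if i.val + j.val + 1 = 3 then (1 : L) else 0) (IsCMField.complexConj_ne_one L) w hw (1 : ((cmDatum L 3 (Matrix.of fun i j : Fin 3 => if i.val + j.val + 1 = 3 then (1 : L) else 0)).Local v)) : ↥(unitaryGroupOfForm (galAdicCompletionMap (L := L) (IsCMField.complexConj L) hw) (placeForm (Matrix.of fun i j : Fin 3 => if i.val + j.val + 1 = 3 then (1 : L) else 0) w.1))) : GL (Fin 3) (w.1.adicCompletion L)) = 1) ∧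
    (∀ g ∈ (unitaryGroupOfForm (galAdicCompletionMap (L := L) (IsCMField.complexConj L) hw) ((StdForm.antidiagonal 3).over (w.1.adicCompletion L))), ∃ y : ((cmDatum L 3 (Matrix.of fun i j : Fin 3 => if i.val + j.val + 1 = 3 then (1 : L) else 0)).Local v), ((localNonsplitEquiv (IsCMField.complexConj L) (Matrix.of fun i j : Fin 3 => if i.val + j.val + 1 = 3 then (1 : L) else 0) (IsCMField.complexConj_ne_one L) w hw y : ↥(unitaryGroupOfForm (galAdicCompletionMap (L := L) (IsCMField.complexConj L) hw) (placeForm (Matrix.of fun i j : Fin 3 => if i.val + j.val + 1 = 3 then (1 : L) else 0) w.1))) : GL (Fin 3) (w.1.adicCompletion L)) = g) ∧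
    (∀ y y' : ((cmDatum L 3 (Matrix.of fun i j : Fin 3 => if i.val + j.val + 1 = 3 then (1 : L) else 0)).Local v), ((localNonsplitEquiv (IsCMField.complexConj L) (Matrix.of fun i j : Fin 3 => if i.val + j.val + 1 = 3 then (1 : L) else 0) (IsCMField.complexConj_ne_one L) w hw y : ↥(unitaryGroupOfForm (galAdicCompletionMap (L := L) (IsCMField.complexConj L) hw) (placeForm (Matrix.of fun i j : Fin 3 => if i.val + j.val + 1 = 3 then (1 : L) else 0) w.1))) : GL (Fin 3) (w.1.adicCompletion L)) = ((localNonsplitEquiv (IsCMField.complexConj L) (Matrix.of fun i j : Fin 3 => if i.val + j.val + 1 = 3 then (1 : L) else 0) (IsCMField.complexConj_ne_one L) w hw y' : ↥(unitaryGroupOfForm (galAdicCompletionMap (L := L) (IsCMField.complexConj L) hw) (placeForm (Matrix.of fun i j : Fin 3 => if i.val + j.val + 1 = 3 then (1 : L) else 0) w.1))) : GL (Fin 3) (w.1.adicCompletion L)) → y = y') ∧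
    (∀ a b : Fin 3, Continuous fun y : ((cmDatum L 3 (Matrix.of fun i j : Fin 3 => if i.val + j.val + 1 = 3 then (1 : L) else 0)).Local v) => (((localNonsplitEquiv (IsCMField.complexConj L) (Matrix.of fun i j : Fin 3 => if i.val + j.val + 1 = 3 then (1 : L) else 0) (IsCMField.complexConj_ne_one L) w hw y : ↥(unitaryGroupOfForm (galAdicCompletionMap (L := L) (IsCMField.complexConj L) hw) (placeForm (Matrix.of fun i j : Fin 3 => if i.val + j.val + 1 = 3 then (1 : L) else 0) w.1))) : GL (Fin 3) (w.1.adicCompletion L)) : Matrix (Fin 3) (Fin 3) (w.1.adicCompletion L)) a b) := by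
  have hT : placeForm (Matrix.of fun i j : Fin 3 => if i.val + j.val + 1 = 3 then (1 : L) else 0) w.1 = formCongr (galAdicCompletionMap (L := L) (IsCMField.complexConj L) hw) (1 : GL (Fin 3) (w.1.adicCompletion L)) ((StdForm.antidiagonal 3).over (w.1.adicCompletion L)) := by
    rw [placeForm_antidiagOne]
    simp [formCongr, Matrix.map_one]
  have hdec : ∀ y : ((cmDatum L 3 (Matrix.of fun i j : Fin 3 => if i.val + j.val + 1 = 3 then (1 : L) else 0)).Local v), (1 : GL (Fin 3) (w.1.adicCompletion L)) * ((localNonsplitEquiv (IsCMField.complexConj L) (Matrix.of fun i j : Fin 3 => if i.val + j.val + 1 = 3 then (1 : L) else 0) (IsCMField.complexConj_ne_one L) w hw y : ↥(unitaryGroupOfForm (galAdicCompletionMap (L := L) (IsCMField.complexConj L) hw) (placeForm (Matrix.of fun i j : Fin 3 => if i.val + j.val + 1 = 3 then (1 : L) else 0) w.1))) : GL (Fin 3) (w.1.adicCompletion L)) * (1 : GL (Fin 3) (w.1.adicCompletion L))⁻¹ = ((localNonsplitEquiv (IsCMField.complexConj L) (Matrix.of fun i j : Fin 3 => if i.val +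 j.val + 1 = 3 then (1 : L) else 0) (IsCMField.complexConj_ne_one L) w hw y : ↥(unitaryGroupOfForm (galAdicCompletionMap (L := L) (IsCMField.complexConj L) hw) (placeForm (Matrix.of fun i j : Fin 3 => if i.val + j.val + 1 = 3 then (1 : L) else 0) w.1))) : GL (Fin 3) (w.1.adicCompletion L)) := fun y => by
    rw [one_mul, inv_one, mul_one]
  refine ⟨fun y => ?_, fun y y' => ?_, ?_, fun g hg => ?_, fun y y' h => ?_, fun a b => ?_⟩
  · have h := conj_localNonsplitEquiv_mem L (Matrix.of fun i j : Fin 3 => if i.val + j.val + 1 = 3 then (1 : L) else 0) v w hw hT y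
    rwa [hdec] at h
  · have h := conj_localNonsplitEquiv_mul L (Matrix.of fun i j : Fin 3 => if i.val + j.val + 1 = 3 then (1 : L) else 0) v w hw (T := 1) y y'
    rwa [hdec, hdec, hdec] at h
  · have h := conj_localNonsplitEquiv_one L (Matrix.of fun i j : Fin 3 => if i.val + j.val + 1 = 3 then (1 : L) else 0) v w hw (T := 1)
    rwa [hdec] at h
  · obtain ⟨y, hy⟩ := exists_conj_localNonsplitEquiv_eq L (Matrix.of fun i j : Fin 3 => if i.val + j.val + 1 = 3 then (1 : L) else 0) v w hw hT hg
    exact ⟨y, by rwa [hdec] at hy⟩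
  · exact conj_localNonsplitEquiv_injective L (Matrix.of fun i j : Fin 3 => if i.val + j.val + 1 = 3 then (1 : L) else 0) v w hw (T := 1) (by rw [hdec, hdec]; exact h)
  · have h := continuous_conj_localNonsplitEquiv_apply L (Matrix.of fun i j : Fin 3 => if i.val + j.val + 1 = 3 then (1 : L) else 0) v w hw (T := 1) a b
    simp only [one_mul, inv_one, mul_one] at h
    exact h

/-! ## §1 The centraliser `C(γ₀)` read through `ψ`: `ψ(C(γ₀)) = Z(U)·C_{U∩N}(u₀) = {ζ • n(a, s)}` -/

/-- **COORDINATES OF CENTRALISER ELEMENTS**: if `ψ γ₀ = u₀ = !![1, 1, −t₀; 0, 1, −1; 0, 0, 1]` and `h ∈ C(γ₀)`, then `ψ h = ζ • n(a, s)` with `σζ·ζ = 1`, `σa = a`, `σs = −s`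
(★ REG-CENT `exists_coe_eq_smul_upperUnipotent_of_commute_regularUnipotent` through the multiplicative frame; `s = b + a²∕2` for REG-CENT՚s `u(a, b)`).
[cite: Rogawski1990, §3.9 p. 32] -/
theorem UnitaryGroup.exists_eq_smul_regCent_of_mem_centralizer {t₀ : (w.1.adicCompletion L)} (γ₀ : ((cmDatum L 3 (Matrix.of fun i j : Fin 3 => if i.val + j.val + 1 = 3 then (1 : L) else 0)).Local v)) (hγ₀ : (((localNonsplitEquiv (IsCMField.complexConj L) (Matrix.of fun i j : Fin 3 => if i.val + j.val + 1 = 3 then (1 : L) else 0) (IsCMField.complexConj_ne_one L) w hw γ₀ : ↥(unitaryGroupOfForm (galAdicCompletionMap (L := L) (IsCMField.complexConj L) hw) (placeForm (Matrix.of fun i j : Fin 3 => if i.val + j.val + 1 = 3 then (1 : L) else 0) w.1))) : GL (Fin 3) (w.1.adicCompletion L)) : Matrix (Fin 3) (Fin 3) (w.1.adicCompletion L)) = !![1, 1, -t₀; 0, 1, -1; 0, 0, 1])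
    {h : ((cmDatum L 3 (Matrix.of fun i j : Fin 3 => if i.val + j.val + 1 = 3 then (1 : L) else 0)).Local v)} (hh : h ∈ (Subgroup.centralizer (({γ₀} : Set ((cmDatum L 3 (Matrix.of fun i j : Fin 3 => if i.val + j.val + 1 = 3 then (1 : L) else 0)).Local v))))) :
    ∃ ζ a s : (w.1.adicCompletion L), (galAdicCompletionMap (L := L) (IsCMField.complexConj L) hw) ζ * ζ = 1 ∧ (galAdicCompletionMap (L := L) (IsCMField.complexConj L) hw) a = a ∧ (galAdicCompletionMap (L := L) (IsCMField.complexConj L) hw) s = -s ∧ (((localNonsplitEquiv (IsCMField.complexConj L) (Matrix.of fun i j : Fin 3 => if i.val + j.val + 1 = 3 then (1 : L) else 0) (IsCMField.complexConj_ne_one L) w hw h : ↥(unitaryGroupOfForm (galAdicCompletionMap (L := L) (IsCMField.complexConj L) hw) (placeForm (Matrix.of fun i j : Fin 3 => if i.val + j.val + 1 = 3 then (1 : L) else 0) w.1))) : GL (Fin 3) (w.1.adicCompletion L)) : Matrix (Fin 3) (Fin 3) (w.1.adicCompletion L)) = ζ • !![1, a, s - a ^ 2 / 2; 0, 1, -a;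 0, 0, 1] := by
  obtain ⟨hU, hmul, -, -, -, -⟩ := frame_dictionary L v w hw
  have h22 : (2 : (w.1.adicCompletion L))⁻¹ * 2 = 1 := inv_mul_cancel₀ (two_ne_zero_adicCompletion L v w)
  have hcomm : ((localNonsplitEquiv (IsCMField.complexConj L) (Matrix.of fun i j : Fin 3 => if i.val + j.val + 1 = 3 then (1 : L) else 0) (IsCMField.complexConj_ne_one L) w hw h : ↥(unitaryGroupOfForm (galAdicCompletionMap (L := L) (IsCMField.complexConj L) hw) (placeForm (Matrix.of fun i j : Fin 3 => if i.val + j.val + 1 = 3 then (1 : L) else 0) w.1))) : GL (Fin 3) (w.1.adicCompletion L)) * ((localNonsplitEquiv (IsCMField.complexConj L) (Matrix.of fun i j : Fin 3 => if i.val + j.val + 1 = 3 then (1 : L) else 0) (IsCMField.complexConj_ne_one L) w hw γ₀ : ↥(unitaryGroupOfForm (galAdicCompletionMap (L := L) (IsCMField.complexConj L) hw) (placeForm (Matrix.of fun i j : Fin 3 => if i.val + j.val + 1 = 3 then (1 : L) else 0) w.1))) : GL (Fin 3) (w.1.adicCompletion L)) = ((localNonsplitEquiv (IsCMField.complexConj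 L) (Matrix.of fun i j : Fin 3 => if i.val + j.val + 1 = 3 then (1 : L) else 0) (IsCMField.complexConj_ne_one L) w hw γ₀ : ↥(unitaryGroupOfForm (galAdicCompletionMap (L := L) (IsCMField.complexConj L) hw) (placeForm (Matrix.of fun i j : Fin 3 => if i.val + j.val + 1 = 3 then (1 : L) else 0) w.1))) : GL (Fin 3) (w.1.adicCompletion L)) * ((localNonsplitEquiv (IsCMField.complexConj L) (Matrix.of fun i j : Fin 3 => if i.val + j.val + 1 = 3 then (1 : L) else 0) (IsCMField.complexConj_ne_one L) w hw h : ↥(unitaryGroupOfForm (galAdicCompletionMap (L := L) (IsCMField.complexConj L) hw) (placeForm (Matrix.of fun i j : Fin 3 => if i.val + j.val + 1 = 3 then (1 : L) else 0) w.1))) : GL (Fin 3) (w.1.adicCompletion L)) := by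
    rw [← hmul, ← hmul, Subgroup.mem_centralizer_singleton_iff.1 hh]
  obtain ⟨z, a, b, hz, ha, hb, hM⟩ :=
    exists_coe_eq_smul_upperUnipotent_of_commute_regularUnipotent (galAdicCompletionMap (L := L) (IsCMField.complexConj L) hw) (gal_invol L v w hw) hγ₀ (hU h) hcomm
  refine ⟨z, a, b + a ^ 2 / 2, hz, ha, ?_, ?_⟩
  · rw [map_add, map_div₀, map_pow, map_ofNat, ha]
    rw [ha] at hb
    linear_combination hb + (a ^ 2) * h22
  · have e : b = b + a ^ 2 / 2 - a ^ 2 / 2 := by ring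
    rw [hM, ha, ← e]

/-- **CONVERSELY**: if `ψ h = ζ • n(a, s)` with `σζ·ζ = 1`, `σa = a`, `σs = −s`, then `h ∈ C(γ₀)` (★ REG-CENT `smul_upperUnipotent_mem_unitaryGroupOfForm_and_commute`, injectivity of `ψ`).
[cite: Rogawski1990, §3.9 p. 32] -/
theorem UnitaryGroup.mem_centralizer_of_eq_smul_regCent {t₀ : (w.1.adicCompletion L)} (γ₀ : ((cmDatum L 3 (Matrix.of fun i j : Fin 3 => if i.val + j.val + 1 = 3 then (1 : L) else 0)).Local v)) (hγ₀ : (((localNonsplitEquiv (IsCMField.complexConj L) (Matrix.of fun i j : Fin 3 => if i.val + j.val + 1 = 3 then (1 : L) else 0) (IsCMField.complexConj_ne_one L) w hw γ₀ : ↥(unitaryGroupOfForm (galAdicCompletionMap (L := L) (IsCMField.complexConj L) hw) (placeForm (Matrix.of fun i j : Fin 3 => if i.val + j.val + 1 = 3 then (1 : L) else 0) w.1))) : GL (Fin 3) (w.1.adicCompletion L)) : Matrix (Fin 3) (Fin 3) (w.1.adicCompletion L)) = !![1, 1, -t₀; 0, 1, -1; 0, 0, 1])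
    {h : ((cmDatum L 3 (Matrix.of fun i j : Fin 3 => if i.val + j.val + 1 = 3 then (1 : L) else 0)).Local v)} {ζ a s : (w.1.adicCompletion L)} (hζ : (galAdicCompletionMap (L := L) (IsCMField.complexConj L) hw) ζ * ζ = 1) (ha : (galAdicCompletionMap (L := L) (IsCMField.complexConj L) hw) a = a) (hs : (galAdicCompletionMap (L := L) (IsCMField.complexConj L) hw) s = -s) (hM : (((localNonsplitEquiv (IsCMField.complexConj L) (Matrix.of fun i j : Fin 3 => if i.val + j.val + 1 = 3 then (1 : L) else 0) (IsCMField.complexConj_ne_one L) w hw h : ↥(unitaryGroupOfForm (galAdicCompletionMap (L := L) (IsCMField.complexConj L) hw) (placeForm (Matrix.of fun i j : Fin 3 => if i.val + j.val + 1 = 3 then (1 : L) else 0) w.1))) : GL (Fin 3) (w.1.adicCompletion L)) : Matrix (Fin 3) (Fin 3) (w.1.adicCompletion L)) = ζ • !![1, a, s - a ^ 2 / 2; 0, 1, -a; 0, 0, 1]) :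
    h ∈ (Subgroup.centralizer (({γ₀} : Set ((cmDatum L 3 (Matrix.of fun i j : Fin 3 => if i.val + j.val + 1 = 3 then (1 : L) else 0)).Local v)))) := by
  obtain ⟨-, hmul, -, -, hinj, -⟩ := frame_dictionary L v w hw
  have h22 : (2 : (w.1.adicCompletion L))⁻¹ * 2 = 1 := inv_mul_cancel₀ (two_ne_zero_adicCompletion L v w)
  have hb : (s - a ^ 2 / 2) + (galAdicCompletionMap (L := L) (IsCMField.complexConj L) hw) (s - a ^ 2 / 2) + a * (galAdicCompletionMap (L := L) (IsCMField.complexConj L) hw) a = 0 := by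
    rw [map_sub, map_div₀, map_pow, map_ofNat, hs, ha]
    linear_combination (-(a ^ 2)) * h22
  have hM' : (((localNonsplitEquiv (IsCMField.complexConj L) (Matrix.of fun i j : Fin 3 => if i.val + j.val + 1 = 3 then (1 : L) else 0) (IsCMField.complexConj_ne_one L) w hw h : ↥(unitaryGroupOfForm (galAdicCompletionMap (L := L) (IsCMField.complexConj L) hw) (placeForm (Matrix.of fun i j : Fin 3 => if i.val + j.val + 1 = 3 then (1 : L) else 0) w.1))) : GL (Fin 3) (w.1.adicCompletion L)) : Matrix (Fin 3) (Fin 3) (w.1.adicCompletion L)) = ζ • !![1, a, s - a ^ 2 / 2; 0, 1, -(galAdicCompletionMap (L := L) (IsCMField.complexConj L) hw) a; 0, 0, 1] := by rw [hM, ha]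
  obtain ⟨-, hcomm⟩ := smul_upperUnipotent_mem_unitaryGroupOfForm_and_commute (galAdicCompletionMap (L := L) (IsCMField.complexConj L) hw) (gal_invol L v w hw) hζ ha hb hγ₀ hM'
  exact Subgroup.mem_centralizer_singleton_iff.2 (hinj _ _ (by rw [hmul, hmul, hcomm]))

/-! ## §2 (S1) The ball subgroups `S(rₐ, r)` of `C(γ₀)`: existence with the membership predicate, openness, closedness -/

/-- `(ψ h)₀₀ ≠ 0` on the centraliser (it is the unitary scalar `ζ`). [cite: Rogawski1990, §3.9 p. 32] -/
private theorem apply00_ne_zero {t₀ : (w.1.adicCompletion L)} (γ₀ : ((cmDatum L 3 (Matrix.of fun i j : Fin 3 => if i.val + j.val + 1 = 3 then (1 : L) else 0)).Local v)) (hγ₀ : (((localNonsplitEquiv (IsCMField.complexConj L) (Matrix.of fun i j : Fin 3 => if i.val + j.val + 1 = 3 then (1 : L) else 0) (IsCMField.complexConj_ne_one L) w hw γ₀ : ↥(unitaryGroupOfForm (galAdicCompletionMap (L := L) (IsCMField.complexConj L) hw) (placeForm (Matrix.of fun i j : Fin 3 => if i.val + j.val + 1 = 3 then (1 : L) else 0)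 w.1))) : GL (Fin 3) (w.1.adicCompletion L)) : Matrix (Fin 3) (Fin 3) (w.1.adicCompletion L)) = !![1, 1, -t₀; 0, 1, -1; 0, 0, 1]) (h : ↥(Subgroup.centralizer (({γ₀} : Set ((cmDatum L 3 (Matrix.of fun i j : Fin 3 => if i.val + j.val + 1 = 3 then (1 : L) else 0)).Local v))))) :
    (((localNonsplitEquiv (IsCMField.complexConj L) (Matrix.of fun i j : Fin 3 => if i.val + j.val + 1 = 3 then (1 : L) else 0) (IsCMField.complexConj_ne_one L) w hw (h : ((cmDatum L 3 (Matrix.of fun i j : Fin 3 => if i.val + j.val + 1 = 3 then (1 : L) else 0)).Local v)) : ↥(unitaryGroupOfForm (galAdicCompletionMap (L := L) (IsCMField.complexConj L) hw) (placeForm (Matrix.of fun i j : Fin 3 => if i.val + j.val + 1 = 3 then (1 : L) else 0) w.1))) : GL (Fin 3) (w.1.adicCompletion L)) : Matrix (Fin 3) (Fin 3) (w.1.adicCompletion L)) 0 0 ≠ 0 := by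
  obtain ⟨ζ, a, s, hζ, -, -, hM⟩ := UnitaryGroup.exists_eq_smul_regCent_of_mem_centralizer L v w hw γ₀ hγ₀ h.2
  rw [hM]
  simp [right_ne_zero_of_mul_eq_one hζ]

/-- The coordinate `a(h) = (ψh)₀₁ ∕ (ψh)₀₀` is continuous on `C(γ₀)` (`L_w` is a topological division ring; the denominator does not vanish). [cite: Rogawski1990, §3.9 p. 32] -/
private theorem continuous_coordA {t₀ : (w.1.adicCompletion L)} (γ₀ : ((cmDatum L 3 (Matrix.of fun i j : Fin 3 => if i.val + j.val + 1 = 3 then (1 : L) else 0)).Local v)) (hγ₀ : (((localNonsplitEquiv (IsCMField.complexConj L) (Matrix.of fun i j : Fin 3 => if i.val + j.val + 1 = 3 then (1 : L) else 0) (IsCMField.complexConj_ne_one L) w hw γ₀ : ↥(unitaryGroupOfForm (galAdicCompletionMap (L := L) (IsCMField.complexConj L) hw) (placeForm (Matrix.of fun i j : Fin 3 => if i.val + j.val + 1 = 3 then (1 : L) else 0) w.1))) : GL (Fin 3) (w.1.adicCompletion L)) : Matrix (Fin 3) (Fin 3) (w.1.adicCompletion L)) = !![1, 1, -t₀; 0,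 1, -1; 0, 0, 1]) :
    Continuous fun h : ↥(Subgroup.centralizer (({γ₀} : Set ((cmDatum L 3 (Matrix.of fun i j : Fin 3 => if i.val + j.val + 1 = 3 then (1 : L) else 0)).Local v)))) => (((localNonsplitEquiv (IsCMField.complexConj L) (Matrix.of fun i j : Fin 3 => if i.val + j.val + 1 = 3 then (1 : L) else 0) (IsCMField.complexConj_ne_one L) w hw (h : ((cmDatum L 3 (Matrix.of fun i j : Fin 3 => if i.val + j.val + 1 = 3 then (1 : L) else 0)).Local v)) : ↥(unitaryGroupOfForm (galAdicCompletionMap (L := L) (IsCMField.complexConj L) hw) (placeForm (Matrix.of fun i j : Fin 3 => if i.val + j.val + 1 = 3 then (1 : L) else 0) w.1))) : GL (Fin 3) (w.1.adicCompletion L)) : Matrix (Fin 3) (Fin 3) (w.1.adicCompletion L)) 0 1 / (((localNonsplitEquiv (IsCMField.complexConj L) (Matrix.of fun i j : Fin 3 => if i.val + j.val + 1 = 3 then (1 : L) else 0) (IsCMField.complexConj_ne_one L) w hw (h : ((cmDatum L 3 (Matrix.of fun i j : Fin 3 => if i.val + j.val + 1 = 3 then (1 : L) else 0)).Local v)) :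 ↥(unitaryGroupOfForm (galAdicCompletionMap (L := L) (IsCMField.complexConj L) hw) (placeForm (Matrix.of fun i j : Fin 3 => if i.val + j.val + 1 = 3 then (1 : L) else 0) w.1))) : GL (Fin 3) (w.1.adicCompletion L)) : Matrix (Fin 3) (Fin 3) (w.1.adicCompletion L)) 0 0 := by
  obtain ⟨-, -, -, -, -, hcont⟩ := frame_dictionary L v w hw
  exact ((hcont 0 1).comp continuous_subtype_val).div ((hcont 0 0).comp continuous_subtype_val) (apply00_ne_zero L v w hw γ₀ hγ₀)

/-- The coordinate `s(h) = (ψh)₀₂ ∕ (ψh)₀₀ + a(h)² ∕ 2` is continuous on `C(γ₀)`. [cite: Rogawski1990, §3.9 p. 32] -/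
private theorem continuous_coordS {t₀ : (w.1.adicCompletion L)} (γ₀ : ((cmDatum L 3 (Matrix.of fun i j : Fin 3 => if i.val + j.val + 1 = 3 then (1 : L) else 0)).Local v)) (hγ₀ : (((localNonsplitEquiv (IsCMField.complexConj L) (Matrix.of fun i j : Fin 3 => if i.val + j.val + 1 = 3 then (1 : L) else 0) (IsCMField.complexConj_ne_one L) w hw γ₀ : ↥(unitaryGroupOfForm (galAdicCompletionMap (L := L) (IsCMField.complexConj L) hw) (placeForm (Matrix.of fun i j : Fin 3 => if i.val + j.val + 1 = 3 then (1 : L) else 0) w.1))) : GL (Fin 3) (w.1.adicCompletion L)) : Matrix (Fin 3) (Fin 3) (w.1.adicCompletion L)) = !![1, 1, -t₀; 0, 1, -1; 0, 0, 1]) :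
    Continuous fun h : ↥(Subgroup.centralizer (({γ₀} : Set ((cmDatum L 3 (Matrix.of fun i j : Fin 3 => if i.val + j.val + 1 = 3 then (1 : L) else 0)).Local v)))) => (((localNonsplitEquiv (IsCMField.complexConj L) (Matrix.of fun i j : Fin 3 => if i.val + j.val + 1 = 3 then (1 : L) else 0) (IsCMField.complexConj_ne_one L) w hw (h : ((cmDatum L 3 (Matrix.of fun i j : Fin 3 => if i.val + j.val + 1 = 3 then (1 : L) else 0)).Local v)) : ↥(unitaryGroupOfForm (galAdicCompletionMap (L := L) (IsCMField.complexConj L) hw) (placeForm (Matrix.of fun i j : Fin 3 => if i.val + j.val + 1 = 3 then (1 : L) else 0) w.1))) : GL (Fin 3) (w.1.adicCompletion L)) : Matrix (Fin 3) (Fin 3) (w.1.adicCompletion L)) 0 2 / (((localNonsplitEquiv (IsCMField.complexConj L) (Matrix.of fun i j : Fin 3 => if i.val + j.val + 1 = 3 then (1 : L) else 0) (IsCMField.complexConj_ne_one L) w hw (h : ((cmDatum L 3 (Matrix.of fun i j : Fin 3 => if i.val + j.val + 1 = 3 then (1 : L) else 0)).Local v)) : ↥(unitaryGroupOfForm (galAdicCompletionMap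 (L := L) (IsCMField.complexConj L) hw) (placeForm (Matrix.of fun i j : Fin 3 => if i.val + j.val + 1 = 3 then (1 : L) else 0) w.1))) : GL (Fin 3) (w.1.adicCompletion L)) : Matrix (Fin 3) (Fin 3) (w.1.adicCompletion L)) 0 0 + ((((localNonsplitEquiv (IsCMField.complexConj L) (Matrix.of fun i j : Fin 3 => if i.val + j.val + 1 = 3 then (1 : L) else 0) (IsCMField.complexConj_ne_one L) w hw (h : ((cmDatum L 3 (Matrix.of fun i j : Fin 3 => if i.val + j.val + 1 = 3 then (1 : L) else 0)).Local v)) : ↥(unitaryGroupOfForm (galAdicCompletionMap (L := L) (IsCMField.complexConj L) hw) (placeForm (Matrix.of fun i j : Fin 3 => if i.val + j.val + 1 = 3 then (1 : L) else 0) w.1))) : GL (Fin 3) (w.1.adicCompletion L)) : Matrix (Fin 3) (Fin 3) (w.1.adicCompletion L)) 0 1 / (((localNonsplitEquiv (IsCMField.complexConj L) (Matrix.of fun i j : Fin 3 => if i.val + j.val + 1 = 3 then (1 : L) else 0) (IsCMField.complexConj_ne_one L) w hw (h : ((cmDatum L 3 (Matrix.of fun i j : Fin 3 => if i.val + j.val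 + 1 = 3 then (1 : L) else 0)).Local v)) : ↥(unitaryGroupOfForm (galAdicCompletionMap (L := L) (IsCMField.complexConj L) hw) (placeForm (Matrix.of fun i j : Fin 3 => if i.val + j.val + 1 = 3 then (1 : L) else 0) w.1))) : GL (Fin 3) (w.1.adicCompletion L)) : Matrix (Fin 3) (Fin 3) (w.1.adicCompletion L)) 0 0) ^ 2 / 2 := by
  obtain ⟨-, -, -, -, -, hcont⟩ := frame_dictionary L v w hw
  exact (((hcont 0 2).comp continuous_subtype_val).div ((hcont 0 0).comp continuous_subtype_val) (apply00_ne_zero L v w hw γ₀ hγ₀)).add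
    (((continuous_coordA L v w hw γ₀ hγ₀).pow 2).div_const 2)

/-- Reading the coordinates off `ψ h = ζ • n(a, s)`: `a(h) = a`, `s(h) = s`. [cite: Rogawski1990, §3.9 p. 32] -/
private theorem read_coords (h : ((cmDatum L 3 (Matrix.of fun i j : Fin 3 => if i.val + j.val + 1 = 3 then (1 : L) else 0)).Local v)) {ζ a s : (w.1.adicCompletion L)} (hζ : (galAdicCompletionMap (L := L) (IsCMField.complexConj L) hw) ζ * ζ = 1) (hM : (((localNonsplitEquiv (IsCMField.complexConj L) (Matrix.of fun i j : Fin 3 => if i.val + j.val + 1 = 3 then (1 : L) else 0) (IsCMField.complexConj_ne_one L) w hw h : ↥(unitaryGroupOfForm (galAdicCompletionMap (L := L) (IsCMField.complexConj L) hw) (placeForm (Matrix.of fun i j : Fin 3 => if i.val + j.val + 1 = 3 then (1 : L) else 0) w.1))) : GL (Fin 3) (w.1.adicCompletion L)) : Matrix (Fin 3) (Fin 3) (w.1.adicCompletion L)) = ζ • !![1, a, s - a ^ 2 / 2; 0, 1, -a; 0, 0, 1]) :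
    (((localNonsplitEquiv (IsCMField.complexConj L) (Matrix.of fun i j : Fin 3 => if i.val + j.val + 1 = 3 then (1 : L) else 0) (IsCMField.complexConj_ne_one L) w hw h : ↥(unitaryGroupOfForm (galAdicCompletionMap (L := L) (IsCMField.complexConj L) hw) (placeForm (Matrix.of fun i j : Fin 3 => if i.val + j.val + 1 = 3 then (1 : L) else 0) w.1))) : GL (Fin 3) (w.1.adicCompletion L)) : Matrix (Fin 3) (Fin 3) (w.1.adicCompletion L)) 0 1 / (((localNonsplitEquiv (IsCMField.complexConj L) (Matrix.of fun i j : Fin 3 => if i.val + j.val + 1 = 3 then (1 : L) else 0) (IsCMField.complexConj_ne_one L) w hw h : ↥(unitaryGroupOfForm (galAdicCompletionMap (L := L) (IsCMField.complexConj L) hw) (placeForm (Matrix.of fun i j : Fin 3 => if i.val + j.val + 1 = 3 then (1 : L) else 0) w.1))) : GL (Fin 3) (w.1.adicCompletion L)) : Matrix (Fin 3) (Fin 3) (w.1.adicCompletion L)) 0 0 = a ∧ (((localNonsplitEquiv (IsCMField.complexConj L) (Matrix.of fun i j : Fin 3 => if i.val + j.val + 1 = 3 then (1 : L) else 0) (IsCMField.complexConj_ne_one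 L) w hw h : ↥(unitaryGroupOfForm (galAdicCompletionMap (L := L) (IsCMField.complexConj L) hw) (placeForm (Matrix.of fun i j : Fin 3 => if i.val + j.val + 1 = 3 then (1 : L) else 0) w.1))) : GL (Fin 3) (w.1.adicCompletion L)) : Matrix (Fin 3) (Fin 3) (w.1.adicCompletion L)) 0 2 / (((localNonsplitEquiv (IsCMField.complexConj L) (Matrix.of fun i j : Fin 3 => if i.val + j.val + 1 = 3 then (1 : L) else 0) (IsCMField.complexConj_ne_one L) w hw h : ↥(unitaryGroupOfForm (galAdicCompletionMap (L := L) (IsCMField.complexConj L) hw) (placeForm (Matrix.of fun i j : Fin 3 => if i.val + j.val + 1 = 3 then (1 : L) else 0) w.1))) : GL (Fin 3) (w.1.adicCompletion L)) : Matrix (Fin 3) (Fin 3) (w.1.adicCompletion L)) 0 0 + ((((localNonsplitEquiv (IsCMField.complexConj L) (Matrix.of fun i j : Fin 3 => if i.val + j.val + 1 = 3 then (1 : L) else 0) (IsCMField.complexConj_ne_one L) w hw h : ↥(unitaryGroupOfForm (galAdicCompletionMap (L := L) (IsCMField.complexConj L) hw) (placeForm (Matrix.of fun i j : Fin 3 =>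 if i.val + j.val + 1 = 3 then (1 : L) else 0) w.1))) : GL (Fin 3) (w.1.adicCompletion L)) : Matrix (Fin 3) (Fin 3) (w.1.adicCompletion L)) 0 1 / (((localNonsplitEquiv (IsCMField.complexConj L) (Matrix.of fun i j : Fin 3 => if i.val + j.val + 1 = 3 then (1 : L) else 0) (IsCMField.complexConj_ne_one L) w hw h : ↥(unitaryGroupOfForm (galAdicCompletionMap (L := L) (IsCMField.complexConj L) hw) (placeForm (Matrix.of fun i j : Fin 3 => if i.val + j.val + 1 = 3 then (1 : L) else 0) w.1))) : GL (Fin 3) (w.1.adicCompletion L)) : Matrix (Fin 3) (Fin 3) (w.1.adicCompletion L)) 0 0) ^ 2 / 2 = s := by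
  have hζ0 : ζ ≠ 0 := right_ne_zero_of_mul_eq_one hζ
  have e00 : (((localNonsplitEquiv (IsCMField.complexConj L) (Matrix.of fun i j : Fin 3 => if i.val + j.val + 1 = 3 then (1 : L) else 0) (IsCMField.complexConj_ne_one L) w hw h : ↥(unitaryGroupOfForm (galAdicCompletionMap (L := L) (IsCMField.complexConj L) hw) (placeForm (Matrix.of fun i j : Fin 3 => if i.val + j.val + 1 = 3 then (1 : L) else 0) w.1))) : GL (Fin 3) (w.1.adicCompletion L)) : Matrix (Fin 3) (Fin 3) (w.1.adicCompletion L)) 0 0 = ζ := by rw [hM]; simp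
  have e01 : (((localNonsplitEquiv (IsCMField.complexConj L) (Matrix.of fun i j : Fin 3 => if i.val + j.val + 1 = 3 then (1 : L) else 0) (IsCMField.complexConj_ne_one L) w hw h : ↥(unitaryGroupOfForm (galAdicCompletionMap (L := L) (IsCMField.complexConj L) hw) (placeForm (Matrix.of fun i j : Fin 3 => if i.val + j.val + 1 = 3 then (1 : L) else 0) w.1))) : GL (Fin 3) (w.1.adicCompletion L)) : Matrix (Fin 3) (Fin 3) (w.1.adicCompletion L)) 0 1 = ζ * a := by rw [hM]; simp
  have e02 : (((localNonsplitEquiv (IsCMField.complexConj L) (Matrix.of fun i j : Fin 3 => if i.val + j.val + 1 = 3 then (1 : L) else 0) (IsCMField.complexConj_ne_one L) w hw h : ↥(unitaryGroupOfForm (galAdicCompletionMap (L := L) (IsCMField.complexConj L) hw) (placeForm (Matrix.of fun i j : Fin 3 => if i.val + j.val + 1 = 3 then (1 : L) else 0) w.1))) : GL (Fin 3) (w.1.adicCompletion L)) : Matrix (Fin 3) (Fin 3) (w.1.adicCompletion L)) 0 2 = ζ * (s - a ^ 2 / 2) := by rw [hM]; simp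
  rw [e00, e01, e02, mul_div_cancel_left₀ _ hζ0, mul_div_cancel_left₀ _ hζ0, sub_add_cancel]
  exact ⟨rfl, rfl⟩

/-- The two coordinates cut out every ball subgroup: for `S ≤ C(γ₀)` with the `(rₐ, r)` membership predicate, `S = a⁻¹{v ≤ rₐ} ∩ s⁻¹{v ≤ r}` as a subset of `C(γ₀)`.
[cite: Rogawski1990, §3.9 p. 32; §8.1 p. 112] [cite: Rao1972, Theorem] -/
private theorem coe_centralizerBall_eq_preimage {t₀ : (w.1.adicCompletion L)} (γ₀ : ((cmDatum L 3 (Matrix.of fun i j : Fin 3 => if i.val + j.val + 1 = 3 then (1 : L) else 0)).Local v)) (hγ₀ : (((localNonsplitEquiv (IsCMField.complexConj L) (Matrix.of fun i j : Fin 3 => if i.val + j.val + 1 = 3 then (1 : L) else 0) (IsCMField.complexConj_ne_one L) w hw γ₀ : ↥(unitaryGroupOfForm (galAdicCompletionMap (L := L) (IsCMField.complexConj L) hw) (placeForm (Matrix.of fun i j : Fin 3 => if i.val + j.val + 1 = 3 then (1 : L) else 0) w.1))) : GL (Fin 3) (w.1.adicCompletion L)) : Matrix (Fin 3) (Fin 3)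 (w.1.adicCompletion L)) = !![1, 1, -t₀; 0, 1, -1; 0, 0, 1])
    {ra r : ℤᵐ⁰} {S : Subgroup ↥(Subgroup.centralizer (({γ₀} : Set ((cmDatum L 3 (Matrix.of fun i j : Fin 3 => if i.val + j.val + 1 = 3 then (1 : L) else 0)).Local v))))} (hS : ∀ h : ↥(Subgroup.centralizer (({γ₀} : Set ((cmDatum L 3 (Matrix.of fun i j : Fin 3 => if i.val + j.val + 1 = 3 then (1 : L) else 0)).Local v)))), h ∈ S ↔ ∃ ζ a s : (w.1.adicCompletion L), (galAdicCompletionMap (L := L) (IsCMField.complexConj L) hw) ζ * ζ = 1 ∧ (galAdicCompletionMap (L := L) (IsCMField.complexConj L) hw) a = a ∧ (galAdicCompletionMap (L := L) (IsCMField.complexConj L) hw) s = -s ∧ Valued.v a ≤ ra ∧ Valued.v s ≤ r ∧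
          (((localNonsplitEquiv (IsCMField.complexConj L) (Matrix.of fun i j : Fin 3 => if i.val + j.val + 1 = 3 then (1 : L) else 0) (IsCMField.complexConj_ne_one L) w hw (h : ((cmDatum L 3 (Matrix.of fun i j : Fin 3 => if i.val + j.val + 1 = 3 then (1 : L) else 0)).Local v)) : ↥(unitaryGroupOfForm (galAdicCompletionMap (L := L) (IsCMField.complexConj L) hw) (placeForm (Matrix.of fun i j : Fin 3 => if i.val + j.val + 1 = 3 then (1 : L) else 0) w.1))) : GL (Fin 3) (w.1.adicCompletion L)) : Matrix (Fin 3) (Fin 3) (w.1.adicCompletion L)) = ζ • !![1, a, s - a ^ 2 / 2; 0, 1, -a; 0, 0, 1]) :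
    (S : Set ↥(Subgroup.centralizer (({γ₀} : Set ((cmDatum L 3 (Matrix.of fun i j : Fin 3 => if i.val + j.val + 1 = 3 then (1 : L) else 0)).Local v))))) = (fun h : ↥(Subgroup.centralizer (({γ₀} : Set ((cmDatum L 3 (Matrix.of fun i j : Fin 3 => if i.val + j.val + 1 = 3 then (1 : L) else 0)).Local v)))) => (((localNonsplitEquiv (IsCMField.complexConj L) (Matrix.of fun i j : Fin 3 => if i.val + j.val + 1 = 3 then (1 : L) else 0) (IsCMField.complexConj_ne_one L) w hw (h : ((cmDatum L 3 (Matrix.of fun i j : Fin 3 => if i.val + j.val + 1 = 3 then (1 : L) else 0)).Local v)) : ↥(unitaryGroupOfForm (galAdicCompletionMap (L := L) (IsCMField.complexConj L) hw) (placeForm (Matrix.of fun i j : Fin 3 => if i.val + j.val + 1 = 3 then (1 : L) else 0) w.1))) : GL (Fin 3) (w.1.adicCompletion L)) : Matrix (Fin 3) (Fin 3) (w.1.adicCompletion L)) 0 1 / (((localNonsplitEquiv (IsCMField.complexConj L) (Matrix.of fun i j : Fin 3 => if i.val + j.val + 1 = 3 then (1 : L) else 0) (IsCMField.complexConj_ne_one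 L) w hw (h : ((cmDatum L 3 (Matrix.of fun i j : Fin 3 => if i.val + j.val + 1 = 3 then (1 : L) else 0)).Local v)) : ↥(unitaryGroupOfForm (galAdicCompletionMap (L := L) (IsCMField.complexConj L) hw) (placeForm (Matrix.of fun i j : Fin 3 => if i.val + j.val + 1 = 3 then (1 : L) else 0) w.1))) : GL (Fin 3) (w.1.adicCompletion L)) : Matrix (Fin 3) (Fin 3) (w.1.adicCompletion L)) 0 0) ⁻¹' {x | Valued.v x ≤ ra} ∩
      (fun h : ↥(Subgroup.centralizer (({γ₀} : Set ((cmDatum L 3 (Matrix.of fun i j : Fin 3 => if i.val + j.val + 1 = 3 then (1 : L) else 0)).Local v)))) => (((localNonsplitEquiv (IsCMField.complexConj L) (Matrix.of fun i j : Fin 3 => if i.val + j.val + 1 = 3 then (1 : L) else 0) (IsCMField.complexConj_ne_one L) w hw (h : ((cmDatum L 3 (Matrix.of fun i j : Fin 3 => if i.val + j.val + 1 = 3 then (1 : L) else 0)).Local v)) : ↥(unitaryGroupOfForm (galAdicCompletionMap (L := L) (IsCMField.complexConj L) hw) (placeForm (Matrix.of fun i j : Fin 3 => if i.val + j.val + 1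 = 3 then (1 : L) else 0) w.1))) : GL (Fin 3) (w.1.adicCompletion L)) : Matrix (Fin 3) (Fin 3) (w.1.adicCompletion L)) 0 2 / (((localNonsplitEquiv (IsCMField.complexConj L) (Matrix.of fun i j : Fin 3 => if i.val + j.val + 1 = 3 then (1 : L) else 0) (IsCMField.complexConj_ne_one L) w hw (h : ((cmDatum L 3 (Matrix.of fun i j : Fin 3 => if i.val + j.val + 1 = 3 then (1 : L) else 0)).Local v)) : ↥(unitaryGroupOfForm (galAdicCompletionMap (L := L) (IsCMField.complexConj L) hw) (placeForm (Matrix.of fun i j : Fin 3 => if i.val + j.val + 1 = 3 then (1 : L) else 0) w.1))) : GL (Fin 3) (w.1.adicCompletion L)) : Matrix (Fin 3) (Fin 3) (w.1.adicCompletion L)) 0 0 + ((((localNonsplitEquiv (IsCMField.complexConj L) (Matrix.of fun i j : Fin 3 => if i.val + j.val + 1 = 3 then (1 : L) else 0) (IsCMField.complexConj_ne_one L) w hw (h : ((cmDatum L 3 (Matrix.of fun i j : Fin 3 => if i.val + j.val + 1 = 3 then (1 : L) else 0)).Local v)) : ↥(unitaryGroupOfForm (galAdicCompletionMap (L := L)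 (IsCMField.complexConj L) hw) (placeForm (Matrix.of fun i j : Fin 3 => if i.val + j.val + 1 = 3 then (1 : L) else 0) w.1))) : GL (Fin 3) (w.1.adicCompletion L)) : Matrix (Fin 3) (Fin 3) (w.1.adicCompletion L)) 0 1 / (((localNonsplitEquiv (IsCMField.complexConj L) (Matrix.of fun i j : Fin 3 => if i.val + j.val + 1 = 3 then (1 : L) else 0) (IsCMField.complexConj_ne_one L) w hw (h : ((cmDatum L 3 (Matrix.of fun i j : Fin 3 => if i.val + j.val + 1 = 3 then (1 : L) else 0)).Local v)) : ↥(unitaryGroupOfForm (galAdicCompletionMap (L := L) (IsCMField.complexConj L) hw) (placeForm (Matrix.of fun i j : Fin 3 => if i.val + j.val + 1 = 3 then (1 : L) else 0) w.1))) : GL (Fin 3) (w.1.adicCompletion L)) : Matrix (Fin 3) (Fin 3) (w.1.adicCompletion L)) 0 0) ^ 2 / 2) ⁻¹' {x | Valued.v x ≤ r} := by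
  ext h
  rw [SetLike.mem_coe, hS]
  simp only [Set.mem_inter_iff, Set.mem_preimage, Set.mem_setOf_eq]
  constructor
  · rintro ⟨ζ, a, s, hζ, -, -, hva, hvs, hM⟩
    obtain ⟨e1, e2⟩ := read_coords L v w hw (h : ((cmDatum L 3 (Matrix.of fun i j : Fin 3 => if i.val + j.val + 1 = 3 then (1 : L) else 0)).Local v)) hζ hM
    rw [e2, e1]
    exact ⟨hva, hvs⟩
  · rintro ⟨hva, hvs⟩
    obtain ⟨ζ, a, s, hζ, ha, hs, hM⟩ := UnitaryGroup.exists_eq_smul_regCent_of_mem_centralizer L v w hw γ₀ hγ₀ h.2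
    obtain ⟨e1, e2⟩ := read_coords L v w hw (h : ((cmDatum L 3 (Matrix.of fun i j : Fin 3 => if i.val + j.val + 1 = 3 then (1 : L) else 0)).Local v)) hζ hM
    rw [e1] at hva
    rw [e2] at hvs
    exact ⟨ζ, a, s, hζ, ha, hs, hva, hvs, hM⟩

/-- **(S1) THE BALL SUBGROUPS `S(rₐ, r)` OF `C(γ₀)` EXIST AND ARE OPEN.**  For `ψ γ₀ = u₀` and radii `rₐ, r ≠ 0` there is a subgroup `S ≤ C(γ₀)` with
`h ∈ S ↔ ∃ ζ a s, σζ·ζ = 1 ∧ σa = a ∧ σs = −s ∧ v a ≤ rₐ ∧ v s ≤ r ∧ ψ h = ζ • n(a, s)` — the pull-back of ★ `exists_subgroup_scalarRegCentBall` along `ψ|_{C(γ₀)}` — and `S` is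
OPEN in `C(γ₀)` (preimage of two clopen valuation balls under the continuous coordinates `a(h)`, `s(h)`; ★ `isClopen_setOf_valued_le`).  These are Ranga Rao՚s compact open
subgroups of the centraliser, level by level. [cite: Rogawski1990, §3.9 p. 32; §8.1 p. 112] [cite: Rao1972, Theorem] -/
theorem UnitaryGroup.exists_centralizerBall {t₀ : (w.1.adicCompletion L)} (γ₀ : ((cmDatum L 3 (Matrix.of fun i j : Fin 3 => if i.val + j.val + 1 = 3 then (1 : L) else 0)).Local v)) (hγ₀ : (((localNonsplitEquiv (IsCMField.complexConj L) (Matrix.of fun i j : Fin 3 => if i.val + j.val + 1 = 3 then (1 : L) else 0) (IsCMField.complexConj_ne_one L) w hw γ₀ : ↥(unitaryGroupOfForm (galAdicCompletionMap (L := L) (IsCMField.complexConj L) hw) (placeForm (Matrix.of fun i j : Fin 3 => if i.val + j.val + 1 = 3 then (1 : L) else 0) w.1))) : GL (Fin 3) (w.1.adicCompletion L)) : Matrix (Fin 3) (Fin 3) (w.1.adicCompletion L)) = !![1, 1, -t₀; 0, 1, -1; 0, 0, 1])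
    (ra r : ℤᵐ⁰) (hra : ra ≠ 0) (hr : r ≠ 0) :
    ∃ S : Subgroup ↥(Subgroup.centralizer (({γ₀} : Set ((cmDatum L 3 (Matrix.of fun i j : Fin 3 => if i.val + j.val + 1 = 3 then (1 : L) else 0)).Local v)))), (∀ h : ↥(Subgroup.centralizer (({γ₀} : Set ((cmDatum L 3 (Matrix.of fun i j : Fin 3 => if i.val + j.val + 1 = 3 then (1 : L) else 0)).Local v)))), h ∈ S ↔ ∃ ζ a s : (w.1.adicCompletion L), (galAdicCompletionMap (L := L) (IsCMField.complexConj L) hw) ζ * ζ = 1 ∧ (galAdicCompletionMap (L := L) (IsCMField.complexConj L) hw) a = a ∧ (galAdicCompletionMap (L := L) (IsCMField.complexConj L) hw) s = -s ∧ Valued.v a ≤ ra ∧ Valued.v s ≤ r ∧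
          (((localNonsplitEquiv (IsCMField.complexConj L) (Matrix.of fun i j : Fin 3 => if i.val + j.val + 1 = 3 then (1 : L) else 0) (IsCMField.complexConj_ne_one L) w hw (h : ((cmDatum L 3 (Matrix.of fun i j : Fin 3 => if i.val + j.val + 1 = 3 then (1 : L) else 0)).Local v)) : ↥(unitaryGroupOfForm (galAdicCompletionMap (L := L) (IsCMField.complexConj L) hw) (placeForm (Matrix.of fun i j : Fin 3 => if i.val + j.val + 1 = 3 then (1 : L) else 0) w.1))) : GL (Fin 3) (w.1.adicCompletion L)) : Matrix (Fin 3) (Fin 3) (w.1.adicCompletion L)) = ζ • !![1, a, s - a ^ 2 / 2; 0, 1, -a; 0, 0, 1]) ∧ IsOpen (S : Set ↥(Subgroup.centralizer (({γ₀} : Set ((cmDatum L 3 (Matrix.of fun i j : Fin 3 => if i.val + j.val + 1 = 3 then (1 : L) else 0)).Local v))))) := by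
  obtain ⟨-, hmul, hone, -, -, -⟩ := frame_dictionary L v w hw
  obtain ⟨T, hT⟩ := exists_subgroup_scalarRegCentBall (galAdicCompletionMap (L := L) (IsCMField.complexConj L) hw) (gal_invol L v w hw) (two_ne_zero_adicCompletion L v w) ra r
  -- `ψ` restricted to the centraliser, as a homomorphism
  let ψH : ↥(Subgroup.centralizer (({γ₀} : Set ((cmDatum L 3 (Matrix.of fun i j : Fin 3 => if i.val + j.val + 1 = 3 then (1 : L) else 0)).Local v)))) →* GL (Fin 3) (w.1.adicCompletion L) :=
    { toFun := fun h => ((localNonsplitEquiv (IsCMField.complexConj L) (Matrix.of fun i j : Fin 3 => if i.val + j.val + 1 = 3 then (1 : L) else 0) (IsCMField.complexConj_ne_one L) w hw (h : ((cmDatum L 3 (Matrix.of fun i j : Fin 3 => if i.val + j.val + 1 = 3 then (1 : L) else 0)).Local v)) : ↥(unitaryGroupOfForm (galAdicCompletionMap (L := L) (IsCMField.complexConj L) hw) (placeForm (Matrix.of fun i j : Fin 3 => if i.val + j.val + 1 = 3 then (1 : L) else 0) w.1))) : GL (Fin 3) (w.1.adicCompletion L))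
      map_one' := by rw [OneMemClass.coe_one]; exact hone
      map_mul' := fun h h' => by rw [Subgroup.coe_mul]; exact hmul _ _ }
  have hmem : ∀ h : ↥(Subgroup.centralizer (({γ₀} : Set ((cmDatum L 3 (Matrix.of fun i j : Fin 3 => if i.val + j.val + 1 = 3 then (1 : L) else 0)).Local v)))), h ∈ T.comap ψH ↔ ∃ ζ a s : (w.1.adicCompletion L), (galAdicCompletionMap (L := L) (IsCMField.complexConj L) hw) ζ * ζ = 1 ∧ (galAdicCompletionMap (L := L) (IsCMField.complexConj L) hw) a = a ∧ (galAdicCompletionMap (L := L) (IsCMField.complexConj L) hw) s = -s ∧ Valued.v a ≤ ra ∧ Valued.v s ≤ r ∧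
          (((localNonsplitEquiv (IsCMField.complexConj L) (Matrix.of fun i j : Fin 3 => if i.val + j.val + 1 = 3 then (1 : L) else 0) (IsCMField.complexConj_ne_one L) w hw (h : ((cmDatum L 3 (Matrix.of fun i j : Fin 3 => if i.val + j.val + 1 = 3 then (1 : L) else 0)).Local v)) : ↥(unitaryGroupOfForm (galAdicCompletionMap (L := L) (IsCMField.complexConj L) hw) (placeForm (Matrix.of fun i j : Fin 3 => if i.val + j.val + 1 = 3 then (1 : L) else 0) w.1))) : GL (Fin 3) (w.1.adicCompletion L)) : Matrix (Fin 3) (Fin 3) (w.1.adicCompletion L)) = ζ • !![1, a, s - a ^ 2 / 2; 0, 1, -a; 0, 0, 1] := fun h => by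
    rw [Subgroup.mem_comap]
    exact hT _
  refine ⟨T.comap ψH, hmem, ?_⟩
  rw [coe_centralizerBall_eq_preimage L v w hw γ₀ hγ₀ hmem]
  exact ((isClopen_setOf_valued_le L w.1 hra).isOpen.preimage (continuous_coordA L v w hw γ₀ hγ₀)).inter
    ((isClopen_setOf_valued_le L w.1 hr).isOpen.preimage (continuous_coordS L v w hw γ₀ hγ₀))

/-- **(S1′) THE BALL SUBGROUPS ARE CLOSED** in `C(γ₀)` (same preimage description, the valuation balls being clopen) — so `S(rₐ, r)` is compact as soon as it sits in a compact
subset of `G` (the consumer՚s `hSc` via absorption into `x⁻¹ K_G x`). [cite: Rogawski1990, §8.1 p. 112] [cite: Rao1972, Theorem] -/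
theorem UnitaryGroup.isClosed_centralizerBall {t₀ : (w.1.adicCompletion L)} (γ₀ : ((cmDatum L 3 (Matrix.of fun i j : Fin 3 => if i.val + j.val + 1 = 3 then (1 : L) else 0)).Local v)) (hγ₀ : (((localNonsplitEquiv (IsCMField.complexConj L) (Matrix.of fun i j : Fin 3 => if i.val + j.val + 1 = 3 then (1 : L) else 0) (IsCMField.complexConj_ne_one L) w hw γ₀ : ↥(unitaryGroupOfForm (galAdicCompletionMap (L := L) (IsCMField.complexConj L) hw) (placeForm (Matrix.of fun i j : Fin 3 => if i.val + j.val + 1 = 3 then (1 : L) else 0) w.1))) : GL (Fin 3) (w.1.adicCompletion L)) : Matrix (Fin 3) (Fin 3) (w.1.adicCompletion L)) = !![1, 1, -t₀; 0, 1, -1; 0, 0, 1])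
    {ra r : ℤᵐ⁰} (hra : ra ≠ 0) (hr : r ≠ 0) {S : Subgroup ↥(Subgroup.centralizer (({γ₀} : Set ((cmDatum L 3 (Matrix.of fun i j : Fin 3 => if i.val + j.val + 1 = 3 then (1 : L) else 0)).Local v))))} (hS : ∀ h : ↥(Subgroup.centralizer (({γ₀} : Set ((cmDatum L 3 (Matrix.of fun i j : Fin 3 => if i.val + j.val + 1 = 3 then (1 : L) else 0)).Local v)))), h ∈ S ↔ ∃ ζ a s : (w.1.adicCompletion L), (galAdicCompletionMap (L := L) (IsCMField.complexConj L) hw) ζ * ζ = 1 ∧ (galAdicCompletionMap (L := L) (IsCMField.complexConj L) hw) a = a ∧ (galAdicCompletionMap (L := L) (IsCMField.complexConj L) hw) s = -s ∧ Valued.v a ≤ ra ∧ Valued.v s ≤ r ∧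
          (((localNonsplitEquiv (IsCMField.complexConj L) (Matrix.of fun i j : Fin 3 => if i.val + j.val + 1 = 3 then (1 : L) else 0) (IsCMField.complexConj_ne_one L) w hw (h : ((cmDatum L 3 (Matrix.of fun i j : Fin 3 => if i.val + j.val + 1 = 3 then (1 : L) else 0)).Local v)) : ↥(unitaryGroupOfForm (galAdicCompletionMap (L := L) (IsCMField.complexConj L) hw) (placeForm (Matrix.of fun i j : Fin 3 => if i.val + j.val + 1 = 3 then (1 : L) else 0) w.1))) : GL (Fin 3) (w.1.adicCompletion L)) : Matrix (Fin 3) (Fin 3) (w.1.adicCompletion L)) = ζ • !![1, a, s - a ^ 2 / 2; 0, 1, -a; 0, 0, 1]) :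
    IsClosed (S : Set ↥(Subgroup.centralizer (({γ₀} : Set ((cmDatum L 3 (Matrix.of fun i j : Fin 3 => if i.val + j.val + 1 = 3 then (1 : L) else 0)).Local v))))) := by
  rw [coe_centralizerBall_eq_preimage L v w hw γ₀ hγ₀ hS]
  exact ((isClopen_setOf_valued_le L w.1 hra).isClosed.preimage (continuous_coordA L v w hw γ₀ hγ₀)).inter
    ((isClopen_setOf_valued_le L w.1 hr).isClosed.preimage (continuous_coordS L v w hw γ₀ hγ₀))

/-- **(S1″) … AND OPEN, for ANY subgroup with the membership predicate** (not only the one produced by (S1); two subgroups with the same predicate coincide anyway).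
[cite: Rogawski1990, §8.1 p. 112] [cite: Rao1972, Theorem] -/
theorem UnitaryGroup.isOpen_centralizerBall {t₀ : (w.1.adicCompletion L)} (γ₀ : ((cmDatum L 3 (Matrix.of fun i j : Fin 3 => if i.val + j.val + 1 = 3 then (1 : L) else 0)).Local v)) (hγ₀ : (((localNonsplitEquiv (IsCMField.complexConj L) (Matrix.of fun i j : Fin 3 => if i.val + j.val + 1 = 3 then (1 : L) else 0) (IsCMField.complexConj_ne_one L) w hw γ₀ : ↥(unitaryGroupOfForm (galAdicCompletionMap (L := L) (IsCMField.complexConj L) hw) (placeForm (Matrix.of fun i j : Fin 3 => if i.val + j.val + 1 = 3 then (1 : L) else 0) w.1))) : GL (Fin 3) (w.1.adicCompletion L)) : Matrix (Fin 3) (Fin 3) (w.1.adicCompletion L)) = !![1, 1, -t₀; 0, 1, -1; 0, 0, 1])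
    {ra r : ℤᵐ⁰} (hra : ra ≠ 0) (hr : r ≠ 0) {S : Subgroup ↥(Subgroup.centralizer (({γ₀} : Set ((cmDatum L 3 (Matrix.of fun i j : Fin 3 => if i.val + j.val + 1 = 3 then (1 : L) else 0)).Local v))))} (hS : ∀ h : ↥(Subgroup.centralizer (({γ₀} : Set ((cmDatum L 3 (Matrix.of fun i j : Fin 3 => if i.val + j.val + 1 = 3 then (1 : L) else 0)).Local v)))), h ∈ S ↔ ∃ ζ a s : (w.1.adicCompletion L), (galAdicCompletionMap (L := L) (IsCMField.complexConj L) hw) ζ * ζ = 1 ∧ (galAdicCompletionMap (L := L) (IsCMField.complexConj L) hw) a = a ∧ (galAdicCompletionMap (L := L) (IsCMField.complexConj L) hw) s = -s ∧ Valued.v a ≤ ra ∧ Valued.v s ≤ r ∧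
          (((localNonsplitEquiv (IsCMField.complexConj L) (Matrix.of fun i j : Fin 3 => if i.val + j.val + 1 = 3 then (1 : L) else 0) (IsCMField.complexConj_ne_one L) w hw (h : ((cmDatum L 3 (Matrix.of fun i j : Fin 3 => if i.val + j.val + 1 = 3 then (1 : L) else 0)).Local v)) : ↥(unitaryGroupOfForm (galAdicCompletionMap (L := L) (IsCMField.complexConj L) hw) (placeForm (Matrix.of fun i j : Fin 3 => if i.val + j.val + 1 = 3 then (1 : L) else 0) w.1))) : GL (Fin 3) (w.1.adicCompletion L)) : Matrix (Fin 3) (Fin 3) (w.1.adicCompletion L)) = ζ • !![1, a, s - a ^ 2 / 2; 0, 1, -a; 0, 0, 1]) :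
    IsOpen (S : Set ↥(Subgroup.centralizer (({γ₀} : Set ((cmDatum L 3 (Matrix.of fun i j : Fin 3 => if i.val + j.val + 1 = 3 then (1 : L) else 0)).Local v))))) := by
  rw [coe_centralizerBall_eq_preimage L v w hw γ₀ hγ₀ hS]
  exact ((isClopen_setOf_valued_le L w.1 hra).isOpen.preimage (continuous_coordA L v w hw γ₀ hγ₀)).inter
    ((isClopen_setOf_valued_le L w.1 hr).isOpen.preimage (continuous_coordS L v w hw γ₀ hγ₀))

/-! ## §3 (S2) The index `[S(rₐ, r′) : S(rₐ, r)]` is the ball index on the anti-invariant line `F⁻ = ker(id + σ_w)` -/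

/-- **(S2) THE INDEX OF THE LEVEL SUBGROUPS IS A BALL INDEX ON THE ANTI-INVARIANT LINE.**  For `ψ γ₀ = u₀` and two subgroups `S, S′ ≤ C(γ₀)` with the membership
predicates of radii `(rₐ, r)` and `(rₐ, r′)`: `S.relIndex S′ = [B_{r′} ⊓ F⁻ : B_r ⊓ F⁻]`, `F⁻ = ker(id + σ_w)`, `B_ρ = {v ≤ ρ}` — transport of ★ `relIndex_scalarRegCentBall_eq`
along the homomorphism `ψ|_{C(γ₀)} : C(γ₀) → GL₃(L_w)` (Mathlib `Subgroup.relIndex_comap`, `Subgroup.map_comap_eq`), using that the GL-level ball subgroup lies in the range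
of `ψ|_{C(γ₀)}` (every `ζ • n(a, s)` is unitary and commutes with `u₀`, ★ REG-CENT, hence is `ψ y` with `y ∈ C(γ₀)`).  No order hypothesis on `r, r′`.  The numeric value is
★ `relIndex_mul_pow_two_le` (`ValuationBallStableSubgroupIndex`) after ★ `relIndex_leAddSubgroup_inf_eq_of_forall_mem_iff` (`F⁻ = ξ·F`). [cite: Rogawski1990, §8.1 p. 112]
[cite: Rao1972, Theorem] -/
theorem UnitaryGroup.relIndex_centralizerBall_eq {t₀ : (w.1.adicCompletion L)} (γ₀ : ((cmDatum L 3 (Matrix.of fun i j : Fin 3 => if i.val + j.val + 1 = 3 then (1 : L) else 0)).Local v)) (hγ₀ : (((localNonsplitEquiv (IsCMField.complexConj L) (Matrix.of fun i j : Fin 3 => if i.val + j.val + 1 = 3 then (1 : L) else 0) (IsCMField.complexConj_ne_one L) w hw γ₀ : ↥(unitaryGroupOfForm (galAdicCompletionMap (L := L) (IsCMField.complexConj L) hw) (placeForm (Matrix.of fun i j : Fin 3 => if i.val + j.val + 1 = 3 then (1 : L) else 0) w.1))) : GL (Fin 3) (w.1.adicCompletion L)) : Matrix (Fin 3) (Fin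 3) (w.1.adicCompletion L)) = !![1, 1, -t₀; 0, 1, -1; 0, 0, 1])
    {ra r r' : ℤᵐ⁰} {S S' : Subgroup ↥(Subgroup.centralizer (({γ₀} : Set ((cmDatum L 3 (Matrix.of fun i j : Fin 3 => if i.val + j.val + 1 = 3 then (1 : L) else 0)).Local v))))}
    (hS : ∀ h : ↥(Subgroup.centralizer (({γ₀} : Set ((cmDatum L 3 (Matrix.of fun i j : Fin 3 => if i.val + j.val + 1 = 3 then (1 : L) else 0)).Local v)))), h ∈ S ↔ ∃ ζ a s : (w.1.adicCompletion L), (galAdicCompletionMap (L := L) (IsCMField.complexConj L) hw) ζ * ζ = 1 ∧ (galAdicCompletionMap (L := L) (IsCMField.complexConj L) hw) a = a ∧ (galAdicCompletionMap (L := L) (IsCMField.complexConj L) hw) s = -s ∧ Valued.v a ≤ ra ∧ Valued.v s ≤ r ∧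
          (((localNonsplitEquiv (IsCMField.complexConj L) (Matrix.of fun i j : Fin 3 => if i.val + j.val + 1 = 3 then (1 : L) else 0) (IsCMField.complexConj_ne_one L) w hw (h : ((cmDatum L 3 (Matrix.of fun i j : Fin 3 => if i.val + j.val + 1 = 3 then (1 : L) else 0)).Local v)) : ↥(unitaryGroupOfForm (galAdicCompletionMap (L := L) (IsCMField.complexConj L) hw) (placeForm (Matrix.of fun i j : Fin 3 => if i.val + j.val + 1 = 3 then (1 : L) else 0) w.1))) : GL (Fin 3) (w.1.adicCompletion L)) : Matrix (Fin 3) (Fin 3) (w.1.adicCompletion L)) = ζ • !![1, a, s - a ^ 2 / 2; 0, 1, -a; 0, 0, 1]) (hS' : ∀ h : ↥(Subgroup.centralizer (({γ₀} : Set ((cmDatum L 3 (Matrix.of fun i j : Fin 3 => if i.val + j.val + 1 = 3 then (1 : L) else 0)).Local v)))), h ∈ S' ↔ ∃ ζ a s : (w.1.adicCompletion L), (galAdicCompletionMap (L := L) (IsCMField.complexConj L) hw) ζ * ζ = 1 ∧ (galAdicCompletionMap (L := L) (IsCMField.complexConj L) hw) a = a ∧ (galAdicCompletionMap (L := L) (IsCMField.complexConj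 L) hw) s = -s ∧ Valued.v a ≤ ra ∧ Valued.v s ≤ r' ∧
          (((localNonsplitEquiv (IsCMField.complexConj L) (Matrix.of fun i j : Fin 3 => if i.val + j.val + 1 = 3 then (1 : L) else 0) (IsCMField.complexConj_ne_one L) w hw (h : ((cmDatum L 3 (Matrix.of fun i j : Fin 3 => if i.val + j.val + 1 = 3 then (1 : L) else 0)).Local v)) : ↥(unitaryGroupOfForm (galAdicCompletionMap (L := L) (IsCMField.complexConj L) hw) (placeForm (Matrix.of fun i j : Fin 3 => if i.val + j.val + 1 = 3 then (1 : L) else 0) w.1))) : GL (Fin 3) (w.1.adicCompletion L)) : Matrix (Fin 3) (Fin 3) (w.1.adicCompletion L)) = ζ • !![1, a, s - a ^ 2 / 2; 0, 1, -a; 0, 0, 1]) :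
    S.relIndex S' = ((Valued.v : Valuation (w.1.adicCompletion L) ℤᵐ⁰).leAddSubgroup r ⊓ (AddMonoidHom.id (w.1.adicCompletion L) + ((galAdicCompletionMap (L := L) (IsCMField.complexConj L) hw) : (w.1.adicCompletion L) →+* (w.1.adicCompletion L)).toAddMonoidHom).ker).relIndex ((Valued.v : Valuation (w.1.adicCompletion L) ℤᵐ⁰).leAddSubgroup r' ⊓ (AddMonoidHom.id (w.1.adicCompletion L) + ((galAdicCompletionMap (L := L) (IsCMField.complexConj L) hw) : (w.1.adicCompletion L) →+* (w.1.adicCompletion L)).toAddMonoidHom).ker) := by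
  classical
  obtain ⟨-, hmul, hone, hsurj, hinj, -⟩ := frame_dictionary L v w hw
  have hσ := gal_invol L v w hw
  have h2 := two_ne_zero_adicCompletion L v w
  have h22 : (2 : (w.1.adicCompletion L))⁻¹ * 2 = 1 := inv_mul_cancel₀ h2
  obtain ⟨T, hT⟩ := exists_subgroup_scalarRegCentBall (galAdicCompletionMap (L := L) (IsCMField.complexConj L) hw) hσ h2 ra r
  obtain ⟨T', hT'⟩ := exists_subgroup_scalarRegCentBall (galAdicCompletionMap (L := L) (IsCMField.complexConj L) hw) hσ h2 ra r'
  -- `ψ` restricted to the centraliser, as a homomorphism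
  let ψH : ↥(Subgroup.centralizer (({γ₀} : Set ((cmDatum L 3 (Matrix.of fun i j : Fin 3 => if i.val + j.val + 1 = 3 then (1 : L) else 0)).Local v)))) →* GL (Fin 3) (w.1.adicCompletion L) :=
    { toFun := fun h => ((localNonsplitEquiv (IsCMField.complexConj L) (Matrix.of fun i j : Fin 3 => if i.val + j.val + 1 = 3 then (1 : L) else 0) (IsCMField.complexConj_ne_one L) w hw (h : ((cmDatum L 3 (Matrix.of fun i j : Fin 3 => if i.val + j.val + 1 = 3 then (1 : L) else 0)).Local v)) : ↥(unitaryGroupOfForm (galAdicCompletionMap (L := L) (IsCMField.complexConj L) hw) (placeForm (Matrix.of fun i j : Fin 3 => if i.val + j.val + 1 = 3 then (1 : L) else 0) w.1))) : GL (Fin 3) (w.1.adicCompletion L))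
      map_one' := by rw [OneMemClass.coe_one]; exact hone
      map_mul' := fun h h' => by rw [Subgroup.coe_mul]; exact hmul _ _ }
  have hSc : S = T.comap ψH := by
    ext h
    rw [hS, Subgroup.mem_comap]
    exact (hT _).symm
  have hS'c : S' = T'.comap ψH := by
    ext h
    rw [hS', Subgroup.mem_comap]
    exact (hT' _).symm
  -- the GL-level ball subgroup lies in the range of `ψ|_{C(γ₀)}`
  have hle : T' ≤ ψH.range := by
    intro g hg
    obtain ⟨ζ, a, s, hζ, ha, hs, -, -, hgM⟩ := (hT' g).1 hg
    have hb : (s - a ^ 2 / 2) + (galAdicCompletionMap (L := L) (IsCMField.complexConj L) hw) (s - a ^ 2 / 2) + a * (galAdicCompletionMap (L := L) (IsCMField.complexConj L) hw) a = 0 := by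
      rw [map_sub, map_div₀, map_pow, map_ofNat, hs, ha]
      linear_combination (-(a ^ 2)) * h22
    have hgM' : (g : Matrix (Fin 3) (Fin 3) (w.1.adicCompletion L)) = ζ • !![1, a, s - a ^ 2 / 2; 0, 1, -(galAdicCompletionMap (L := L) (IsCMField.complexConj L) hw) a; 0, 0, 1] := by rw [hgM, ha]
    obtain ⟨hgU, hcomm⟩ := smul_upperUnipotent_mem_unitaryGroupOfForm_and_commute (galAdicCompletionMap (L := L) (IsCMField.complexConj L) hw) hσ hζ ha hb hγ₀ hgM'
    obtain ⟨y, hy⟩ := hsurj g hgU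
    have hyC : y ∈ (Subgroup.centralizer (({γ₀} : Set ((cmDatum L 3 (Matrix.of fun i j : Fin 3 => if i.val + j.val + 1 = 3 then (1 : L) else 0)).Local v)))) :=
      Subgroup.mem_centralizer_singleton_iff.2 (hinj _ _ (by rw [hmul, hmul, hy, hcomm]))
    exact MonoidHom.mem_range.2 ⟨⟨y, hyC⟩, hy⟩
  rw [hSc, hS'c, Subgroup.relIndex_comap, Subgroup.map_comap_eq, inf_eq_right.2 hle]
  exact relIndex_scalarRegCentBall_eq (galAdicCompletionMap (L := L) (IsCMField.complexConj L) hw) h2 hT hT'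

/-! ## §4 (S3) Monotonicity in the radii -/

/-- **(S3) MONOTONICITY: `S(rₐ, r) ≤ S(rₐ′, r′)` for `rₐ ≤ rₐ′`, `r ≤ r′`** (same coordinates, larger balls; no hypothesis on `γ₀`). [cite: Rogawski1990, §8.1 p. 112] -/
theorem UnitaryGroup.centralizerBall_mono {γ₀ : ((cmDatum L 3 (Matrix.of fun i j : Fin 3 => if i.val + j.val + 1 = 3 then (1 : L) else 0)).Local v)} {ra ra' r r' : ℤᵐ⁰} {S S' : Subgroup ↥(Subgroup.centralizer (({γ₀} : Set ((cmDatum L 3 (Matrix.of fun i j : Fin 3 => if i.val + j.val + 1 = 3 then (1 : L) else 0)).Local v))))}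
    (hS : ∀ h : ↥(Subgroup.centralizer (({γ₀} : Set ((cmDatum L 3 (Matrix.of fun i j : Fin 3 => if i.val + j.val + 1 = 3 then (1 : L) else 0)).Local v)))), h ∈ S ↔ ∃ ζ a s : (w.1.adicCompletion L), (galAdicCompletionMap (L := L) (IsCMField.complexConj L) hw) ζ * ζ = 1 ∧ (galAdicCompletionMap (L := L) (IsCMField.complexConj L) hw) a = a ∧ (galAdicCompletionMap (L := L) (IsCMField.complexConj L) hw) s = -s ∧ Valued.v a ≤ ra ∧ Valued.v s ≤ r ∧
          (((localNonsplitEquiv (IsCMField.complexConj L) (Matrix.of fun i j : Fin 3 => if i.val + j.val + 1 = 3 then (1 : L) else 0) (IsCMField.complexConj_ne_one L) w hw (h : ((cmDatum L 3 (Matrix.of fun i j : Fin 3 => if i.val + j.val + 1 = 3 then (1 : L) else 0)).Local v)) : ↥(unitaryGroupOfForm (galAdicCompletionMap (L := L) (IsCMField.complexConj L) hw) (placeForm (Matrix.of fun i j : Fin 3 => if i.val + j.val + 1 = 3 then (1 : L) else 0) w.1))) : GL (Fin 3) (w.1.adicCompletion L)) : Matrix (Fin 3) (Fin 3) (w.1.adicCompletion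 L)) = ζ • !![1, a, s - a ^ 2 / 2; 0, 1, -a; 0, 0, 1]) (hS' : ∀ h : ↥(Subgroup.centralizer (({γ₀} : Set ((cmDatum L 3 (Matrix.of fun i j : Fin 3 => if i.val + j.val + 1 = 3 then (1 : L) else 0)).Local v)))), h ∈ S' ↔ ∃ ζ a s : (w.1.adicCompletion L), (galAdicCompletionMap (L := L) (IsCMField.complexConj L) hw) ζ * ζ = 1 ∧ (galAdicCompletionMap (L := L) (IsCMField.complexConj L) hw) a = a ∧ (galAdicCompletionMap (L := L) (IsCMField.complexConj L) hw) s = -s ∧ Valued.v a ≤ ra' ∧ Valued.v s ≤ r' ∧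
          (((localNonsplitEquiv (IsCMField.complexConj L) (Matrix.of fun i j : Fin 3 => if i.val + j.val + 1 = 3 then (1 : L) else 0) (IsCMField.complexConj_ne_one L) w hw (h : ((cmDatum L 3 (Matrix.of fun i j : Fin 3 => if i.val + j.val + 1 = 3 then (1 : L) else 0)).Local v)) : ↥(unitaryGroupOfForm (galAdicCompletionMap (L := L) (IsCMField.complexConj L) hw) (placeForm (Matrix.of fun i j : Fin 3 => if i.val + j.val + 1 = 3 then (1 : L) else 0) w.1))) : GL (Fin 3) (w.1.adicCompletion L)) : Matrix (Fin 3) (Fin 3) (w.1.adicCompletion L)) = ζ • !![1, a, s - a ^ 2 / 2; 0, 1, -a; 0, 0, 1])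
    (hra : ra ≤ ra') (hr : r ≤ r') : S ≤ S' := by
  intro h hh
  obtain ⟨ζ, a, s, hζ, ha, hs, hva, hvs, hM⟩ := (hS h).1 hh
  exact (hS' h).2 ⟨ζ, a, s, hζ, ha, hs, hva.trans hra, hvs.trans hr, hM⟩

/-- **Two subgroups of `C(γ₀)` with the SAME membership predicate coincide** (re-anchoring across two `obtain`s of (S1)). [cite: Rogawski1990, §8.1 p. 112] -/
theorem UnitaryGroup.centralizerBall_eq_of_forall_mem_iff {γ₀ : ((cmDatum L 3 (Matrix.of fun i j : Fin 3 => if i.val + j.val + 1 = 3 then (1 : L) else 0)).Local v)} {ra r : ℤᵐ⁰} {S S' : Subgroup ↥(Subgroup.centralizer (({γ₀} : Set ((cmDatum L 3 (Matrix.of fun i j : Fin 3 => if i.val + j.val + 1 = 3 then (1 : L) else 0)).Local v))))}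
    (hS : ∀ h : ↥(Subgroup.centralizer (({γ₀} : Set ((cmDatum L 3 (Matrix.of fun i j : Fin 3 => if i.val + j.val + 1 = 3 then (1 : L) else 0)).Local v)))), h ∈ S ↔ ∃ ζ a s : (w.1.adicCompletion L), (galAdicCompletionMap (L := L) (IsCMField.complexConj L) hw) ζ * ζ = 1 ∧ (galAdicCompletionMap (L := L) (IsCMField.complexConj L) hw) a = a ∧ (galAdicCompletionMap (L := L) (IsCMField.complexConj L) hw) s = -s ∧ Valued.v a ≤ ra ∧ Valued.v s ≤ r ∧
          (((localNonsplitEquiv (IsCMField.complexConj L) (Matrix.of fun i j : Fin 3 => if i.val + j.val + 1 = 3 then (1 : L) else 0) (IsCMField.complexConj_ne_one L) w hw (h : ((cmDatum L 3 (Matrix.of fun i j : Fin 3 => if i.val + j.val + 1 = 3 then (1 : L) else 0)).Local v)) : ↥(unitaryGroupOfForm (galAdicCompletionMap (L := L) (IsCMField.complexConj L) hw) (placeForm (Matrix.of fun i j : Fin 3 => if i.val + j.val + 1 = 3 then (1 : L) else 0) w.1))) : GL (Fin 3) (w.1.adicCompletion L)) : Matrix (Fin 3) (Fin 3) (w.1.adicCompletion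 L)) = ζ • !![1, a, s - a ^ 2 / 2; 0, 1, -a; 0, 0, 1]) (hS' : ∀ h : ↥(Subgroup.centralizer (({γ₀} : Set ((cmDatum L 3 (Matrix.of fun i j : Fin 3 => if i.val + j.val + 1 = 3 then (1 : L) else 0)).Local v)))), h ∈ S' ↔ ∃ ζ a s : (w.1.adicCompletion L), (galAdicCompletionMap (L := L) (IsCMField.complexConj L) hw) ζ * ζ = 1 ∧ (galAdicCompletionMap (L := L) (IsCMField.complexConj L) hw) a = a ∧ (galAdicCompletionMap (L := L) (IsCMField.complexConj L) hw) s = -s ∧ Valued.v a ≤ ra ∧ Valued.v s ≤ r ∧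
          (((localNonsplitEquiv (IsCMField.complexConj L) (Matrix.of fun i j : Fin 3 => if i.val + j.val + 1 = 3 then (1 : L) else 0) (IsCMField.complexConj_ne_one L) w hw (h : ((cmDatum L 3 (Matrix.of fun i j : Fin 3 => if i.val + j.val + 1 = 3 then (1 : L) else 0)).Local v)) : ↥(unitaryGroupOfForm (galAdicCompletionMap (L := L) (IsCMField.complexConj L) hw) (placeForm (Matrix.of fun i j : Fin 3 => if i.val + j.val + 1 = 3 then (1 : L) else 0) w.1))) : GL (Fin 3) (w.1.adicCompletion L)) : Matrix (Fin 3) (Fin 3) (w.1.adicCompletion L)) = ζ • !![1, a, s - a ^ 2 / 2; 0, 1, -a; 0, 0, 1]) : S = S' :=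
  le_antisymm (UnitaryGroup.centralizerBall_mono L v w hw hS hS' le_rfl le_rfl) (UnitaryGroup.centralizerBall_mono L v w hw hS' hS le_rfl le_rfl)

end Literature.NumberTheory.Rogawski1990
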